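import Summits.Ventures.PercRepro.C026KCutChain
import Summits.Ventures.PercRepro.C026GoodDegreeForms

/-!
# ROW C-041 `(G⅔)` on the ONE-SIDED sources, and the «no two-sided Bad source» class (p6, gen 23)

Setting of `C026GoodDegreeBridge` / `C026GoodDegreeForms`: a skeleton `(G; a, b, c)` with probe `c` and
terminals `a, b`; a configuration `S` is the red edge set, `Sᶜ` the blue one; `(D,A)` = the
configurations in which `c, a, b` are pairwise red-joined and pairwise blue-separated; `Good_t` = the
other terminal is red-reachable from `c` avoiding the blue cluster `D_t` of `t`; `Bad` = neither,
`GG` = both.  A source is **one-sided at `a`** when `D_a = {a}` (every edge at `a` red), **one-sided**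
when it is one-sided at `a` or at `b`, **clean** when at both, **two-sided** otherwise.

mine-3's K-cut chain (`C026KCutChain`, `card_bad_le_card_gg_chain`) injects the Bad members of any family
closed under the K-cut map `kcut S one c t` into its GG members.  The family `𝒰_a` of the `(D,A)` sources
one-sided at `a` is such a family (the map only opens edges, so `(D,A)` and `D_a = {a}` are kept):

* `DA_kcut`, `cluster_compl_kcut_eq_singleton` — closure of `𝒰_a` under the K-cut map;
* `card_bad_le_card_gg_oneSidedA` / `card_bad_le_card_gg_oneSidedB` — **`#Bad(𝒰_a) ≤ #GG(𝒰_a)`** and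
  **`#Bad(𝒰_b) ≤ #GG(𝒰_b)`** on every skeleton (the skeleton-level form of (CUT-INJ)), hence
  `2·#Bad₁ ≤ 2·(#GG(𝒰_a) + #GG(𝒰_b))` for the one-sided Bad sources `Bad₁` — a count that is EXACT on
  the hub, the 6-core and W9 (own enumerator, lean-drafts/p6/g23/twin/budget.py);
* `card_bad_le_two_mul_card_gg_of_bad_oneSided` — if every Bad source is one-sided then `#Bad ≤ 2·#GG`;
* `bad_le_GG_SG_of_bad_oneSided`, `goodDegree_of_bad_oneSided` — hence ROW C-041 `(G⅔)`
  (`2·#Bad ≤ 4·#GG + #SG`, i.e. `2·n(D,A) ≤ 3·(#Good_a + #Good_b)`) on every skeleton WITHOUT a two-sided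
  Bad source — with room: the `SG` capacity is untouched;
* `pFun_threeCells_nonneg_of_bad_oneSided` — THEOREM L2 (live probe) on that class.

So the whole difficulty of `(G⅔)` sits in the two-sided Bad sources (both terminal clusters
non-trivial): on the tight graphs every two-sided source is Bad and their deficit `2·#Bad₂` is exactly
the one-sided surplus `4·#GG₁ + #SG₁ − 2·#Bad₁` (6-core: 12 = 12, W9: 236 = 236).  The companion
module `C026TwoSidedFlow` states the reduced Hall condition that closes the general case.
-/

namespace PercRepro

namespace MultiGraph

open Finset

variable {V E : Type*} {G : MultiGraph V E}

/-- The K-cut map only opens edges, so it keeps a `(D,A)` source a `(D,A)` source: red connections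
grow, blue connections shrink. -/
theorem DA_kcut {S : Config E} {a b c one t : V}
    (hS : (G.Conn S c a ∧ G.Conn S c b) ∧ (¬ G.Conn Sᶜ c a ∧ ¬ G.Conn Sᶜ c b ∧ ¬ G.Conn Sᶜ a b)) :
    (G.Conn (G.kcut S one c t) c a ∧ G.Conn (G.kcut S one c t) c b) ∧
      (¬ G.Conn (G.kcut S one c t)ᶜ c a ∧ ¬ G.Conn (G.kcut S one c t)ᶜ c b ∧
        ¬ G.Conn (G.kcut S one c t)ᶜ a b) := by
  have hle : S ≤ G.kcut S one c t := le_kcut S one c t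
  have hle' : (G.kcut S one c t)ᶜ ≤ Sᶜ := compl_le_compl hle
  exact ⟨⟨hS.1.1.mono hle, hS.1.2.mono hle⟩,
    ⟨fun h => hS.2.1 (h.mono hle'), fun h => hS.2.2.1 (h.mono hle'),
      fun h => hS.2.2.2 (h.mono hle')⟩⟩

/-- The K-cut map keeps a trivial blue cluster trivial. -/
theorem cluster_compl_kcut_eq_singleton {S : Config E} {one c t v : V}
    (h : G.cluster Sᶜ v = {v}) : G.cluster (G.kcut S one c t)ᶜ v = {v} := by
  apply Set.Subset.antisymm
  · calc G.cluster (G.kcut S one c t)ᶜ v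
        ⊆ G.cluster Sᶜ v := G.cluster_mono (compl_le_compl (le_kcut S one c t)) v
      _ = {v} := h
  · intro u hu
    rw [Set.mem_singleton_iff] at hu
    rw [hu]
    exact self_mem_cluster G _ v

/-- With a trivial blue cluster at `one`, «`t` is not red-reached from `c` avoiding `one`» is exactly
«not `Good_one`» (the avoided set is the blue cluster of `one`). -/
theorem not_mem_redReach_iff_of_singleton {S : Config E} {one c t : V}
    (h : G.cluster Sᶜ one = {one}) :
    t ∉ G.redReach S one c ↔ ¬ G.WalkAvoiding S (G.cluster Sᶜ one) c t := by
  rw [mem_redReach, h]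

/-- With a trivial blue cluster at `one`, «`t` is red-reached from `c` avoiding `one`» is `Good_one`. -/
theorem mem_redReach_iff_of_singleton {S : Config E} {one c t : V}
    (h : G.cluster Sᶜ one = {one}) :
    t ∈ G.redReach S one c ↔ G.WalkAvoiding S (G.cluster Sᶜ one) c t := by
  rw [mem_redReach, h]

section Count

variable [Fintype V] [DecidableEq V] [Fintype E] [DecidableEq E]

omit [Fintype V] [DecidableEq V] in
open Classical in
/-- **(CUT-INJ) on the skeleton, side `a`**: among the `(D,A)` sources one-sided at `a` (`D_a = {a}`),
the Bad ones are at most the GG ones — the K-cut chain of `C026KCutChain` with `one = a`, `t = b`. -/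
theorem card_bad_le_card_gg_oneSidedA (a b c : V) :
    (univ.filter fun S : Config E => (((G.Conn S c a ∧ G.Conn S c b) ∧
        (¬ G.Conn Sᶜ c a ∧ ¬ G.Conn Sᶜ c b ∧ ¬ G.Conn Sᶜ a b)) ∧ G.cluster Sᶜ a = {a}) ∧
        ¬ (G.WalkAvoiding S (G.cluster Sᶜ a) c b ∨ G.WalkAvoiding S (G.cluster Sᶜ b) c a)).card ≤
      (univ.filter fun S : Config E => (((G.Conn S c a ∧ G.Conn S c b) ∧
        (¬ G.Conn Sᶜ c a ∧ ¬ G.Conn Sᶜ c b ∧ ¬ G.Conn Sᶜ a b)) ∧ G.cluster Sᶜ a = {a}) ∧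
        (G.WalkAvoiding S (G.cluster Sᶜ a) c b ∧ G.WalkAvoiding S (G.cluster Sᶜ b) c a)).card := by
  rcases eq_or_ne c a with hca | hca
  · -- `c = a`: there is no source at all (`c` is blue-joined to itself)
    have h0 : (univ.filter fun S : Config E => (((G.Conn S c a ∧ G.Conn S c b) ∧
        (¬ G.Conn Sᶜ c a ∧ ¬ G.Conn Sᶜ c b ∧ ¬ G.Conn Sᶜ a b)) ∧ G.cluster Sᶜ a = {a}) ∧
        ¬ (G.WalkAvoiding S (G.cluster Sᶜ a) c b ∨
          G.WalkAvoiding S (G.cluster Sᶜ b) c a)).card = 0 := by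
      rw [card_eq_zero, filter_eq_empty_iff]
      intro S _ hS
      have hne := hS.1.1.2.1
      rw [hca] at hne
      exact hne (Conn.refl G _ a)
    rw [h0]
    exact Nat.zero_le _
  · set 𝒰 := univ.filter fun S : Config E => ((G.Conn S c a ∧ G.Conn S c b) ∧
        (¬ G.Conn Sᶜ c a ∧ ¬ G.Conn Sᶜ c b ∧ ¬ G.Conn Sᶜ a b)) ∧ G.cluster Sᶜ a = {a} with h𝒰
    have hmem : ∀ S ∈ 𝒰, G.Conn S c a ∧ a ∉ G.cluster Sᶜ b := by
      intro S hS
      rw [h𝒰, mem_filter] at hS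
      refine ⟨hS.2.1.1.1, ?_⟩
      intro hab
      rw [mem_cluster] at hab
      exact hS.2.1.2.2.2 hab.symm
    have hclosed : ∀ S ∈ 𝒰, b ∉ G.redReach S a c → G.kcut S a c b ∈ 𝒰 := by
      intro S hS _
      rw [h𝒰, mem_filter] at hS ⊢
      exact ⟨mem_univ _, DA_kcut hS.2.1, cluster_compl_kcut_eq_singleton hS.2.2⟩
    have h := card_bad_le_card_gg_chain (G := G) hca 𝒰 hmem hclosed
    have hL : (𝒰.filter fun S => b ∉ G.redReach S a c ∧
        ¬ G.WalkAvoiding S (G.cluster Sᶜ b) c a) =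
        univ.filter fun S : Config E => (((G.Conn S c a ∧ G.Conn S c b) ∧
          (¬ G.Conn Sᶜ c a ∧ ¬ G.Conn Sᶜ c b ∧ ¬ G.Conn Sᶜ a b)) ∧ G.cluster Sᶜ a = {a}) ∧
          ¬ (G.WalkAvoiding S (G.cluster Sᶜ a) c b ∨ G.WalkAvoiding S (G.cluster Sᶜ b) c a) := by
      rw [h𝒰, filter_filter]
      apply filter_congr
      intro S _
      constructor
      · rintro ⟨hS, hb, hna⟩
        refine ⟨hS, ?_⟩
        rw [not_mem_redReach_iff_of_singleton hS.2] at hb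
        rintro (h | h)
        · exact hb h
        · exact hna h
      · rintro ⟨hS, hnot⟩
        refine ⟨hS, ?_, fun h => hnot (Or.inr h)⟩
        rw [not_mem_redReach_iff_of_singleton hS.2]
        exact fun h => hnot (Or.inl h)
    have hR : (𝒰.filter fun S => b ∈ G.redReach S a c ∧
        G.WalkAvoiding S (G.cluster Sᶜ b) c a) =
        univ.filter fun S : Config E => (((G.Conn S c a ∧ G.Conn S c b) ∧
          (¬ G.Conn Sᶜ c a ∧ ¬ G.Conn Sᶜ c b ∧ ¬ G.Conn Sᶜ a b)) ∧ G.cluster Sᶜ a = {a}) ∧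
          (G.WalkAvoiding S (G.cluster Sᶜ a) c b ∧ G.WalkAvoiding S (G.cluster Sᶜ b) c a) := by
      rw [h𝒰, filter_filter]
      apply filter_congr
      intro S _
      constructor
      · rintro ⟨hS, hb, ha⟩
        refine ⟨hS, ?_, ha⟩
        rw [mem_redReach_iff_of_singleton hS.2] at hb
        exact hb
      · rintro ⟨hS, ha, hb⟩
        refine ⟨hS, ?_, hb⟩
        rw [mem_redReach_iff_of_singleton hS.2]
        exact ha
    rw [hL, hR] at h
    exact h

omit [Fintype V] [DecidableEq V] in
open Classical in
/-- **(CUT-INJ) on the skeleton, side `b`**: among the `(D,A)` sources one-sided at `b` (`D_b = {b}`),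
the Bad ones are at most the GG ones — the K-cut chain with `one = b`, `t = a`. -/
theorem card_bad_le_card_gg_oneSidedB (a b c : V) :
    (univ.filter fun S : Config E => (((G.Conn S c a ∧ G.Conn S c b) ∧
        (¬ G.Conn Sᶜ c a ∧ ¬ G.Conn Sᶜ c b ∧ ¬ G.Conn Sᶜ a b)) ∧ G.cluster Sᶜ b = {b}) ∧
        ¬ (G.WalkAvoiding S (G.cluster Sᶜ a) c b ∨ G.WalkAvoiding S (G.cluster Sᶜ b) c a)).card ≤
      (univ.filter fun S : Config E => (((G.Conn S c a ∧ G.Conn S c b) ∧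
        (¬ G.Conn Sᶜ c a ∧ ¬ G.Conn Sᶜ c b ∧ ¬ G.Conn Sᶜ a b)) ∧ G.cluster Sᶜ b = {b}) ∧
        (G.WalkAvoiding S (G.cluster Sᶜ a) c b ∧ G.WalkAvoiding S (G.cluster Sᶜ b) c a)).card := by
  rcases eq_or_ne c b with hcb | hcb
  · have h0 : (univ.filter fun S : Config E => (((G.Conn S c a ∧ G.Conn S c b) ∧
        (¬ G.Conn Sᶜ c a ∧ ¬ G.Conn Sᶜ c b ∧ ¬ G.Conn Sᶜ a b)) ∧ G.cluster Sᶜ b = {b}) ∧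
        ¬ (G.WalkAvoiding S (G.cluster Sᶜ a) c b ∨
          G.WalkAvoiding S (G.cluster Sᶜ b) c a)).card = 0 := by
      rw [card_eq_zero, filter_eq_empty_iff]
      intro S _ hS
      have hne := hS.1.1.2.2.1
      rw [hcb] at hne
      exact hne (Conn.refl G _ b)
    rw [h0]
    exact Nat.zero_le _
  · set 𝒰 := univ.filter fun S : Config E => ((G.Conn S c a ∧ G.Conn S c b) ∧
        (¬ G.Conn Sᶜ c a ∧ ¬ G.Conn Sᶜ c b ∧ ¬ G.Conn Sᶜ a b)) ∧ G.cluster Sᶜ b = {b} with h𝒰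
    have hmem : ∀ S ∈ 𝒰, G.Conn S c b ∧ b ∉ G.cluster Sᶜ a := by
      intro S hS
      rw [h𝒰, mem_filter] at hS
      refine ⟨hS.2.1.1.2, ?_⟩
      intro hab
      rw [mem_cluster] at hab
      exact hS.2.1.2.2.2 hab
    have hclosed : ∀ S ∈ 𝒰, a ∉ G.redReach S b c → G.kcut S b c a ∈ 𝒰 := by
      intro S hS _
      rw [h𝒰, mem_filter] at hS ⊢
      exact ⟨mem_univ _, DA_kcut hS.2.1, cluster_compl_kcut_eq_singleton hS.2.2⟩
    have h := card_bad_le_card_gg_chain (G := G) hcb 𝒰 hmem hclosed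
    have hL : (𝒰.filter fun S => a ∉ G.redReach S b c ∧
        ¬ G.WalkAvoiding S (G.cluster Sᶜ a) c b) =
        univ.filter fun S : Config E => (((G.Conn S c a ∧ G.Conn S c b) ∧
          (¬ G.Conn Sᶜ c a ∧ ¬ G.Conn Sᶜ c b ∧ ¬ G.Conn Sᶜ a b)) ∧ G.cluster Sᶜ b = {b}) ∧
          ¬ (G.WalkAvoiding S (G.cluster Sᶜ a) c b ∨ G.WalkAvoiding S (G.cluster Sᶜ b) c a) := by
      rw [h𝒰, filter_filter]
      apply filter_congr
      intro S _
      constructor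
      · rintro ⟨hS, ha, hnb⟩
        refine ⟨hS, ?_⟩
        rw [not_mem_redReach_iff_of_singleton hS.2] at ha
        rintro (h | h)
        · exact hnb h
        · exact ha h
      · rintro ⟨hS, hnot⟩
        refine ⟨hS, ?_, fun h => hnot (Or.inl h)⟩
        rw [not_mem_redReach_iff_of_singleton hS.2]
        exact fun h => hnot (Or.inr h)
    have hR : (𝒰.filter fun S => a ∈ G.redReach S b c ∧
        G.WalkAvoiding S (G.cluster Sᶜ a) c b) =
        univ.filter fun S : Config E => (((G.Conn S c a ∧ G.Conn S c b) ∧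
          (¬ G.Conn Sᶜ c a ∧ ¬ G.Conn Sᶜ c b ∧ ¬ G.Conn Sᶜ a b)) ∧ G.cluster Sᶜ b = {b}) ∧
          (G.WalkAvoiding S (G.cluster Sᶜ a) c b ∧ G.WalkAvoiding S (G.cluster Sᶜ b) c a) := by
      rw [h𝒰, filter_filter]
      apply filter_congr
      intro S _
      constructor
      · rintro ⟨hS, ha, hb⟩
        refine ⟨hS, hb, ?_⟩
        rw [mem_redReach_iff_of_singleton hS.2] at ha
        exact ha
      · rintro ⟨hS, hb, ha⟩
        refine ⟨hS, ?_, hb⟩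
        rw [mem_redReach_iff_of_singleton hS.2]
        exact ha
    rw [hL, hR] at h
    exact h

omit [Fintype V] [DecidableEq V] in
open Classical in
/-- **No two-sided Bad source ⟹ `#Bad ≤ 2·#GG`**: if every Bad `(D,A)` source is one-sided, the two
K-cut chains bound the Bad sources by the GG sources counted once per side. -/
theorem card_bad_le_two_mul_card_gg_of_bad_oneSided (a b c : V)
    (h1 : ∀ S : Config E, ((G.Conn S c a ∧ G.Conn S c b) ∧
        (¬ G.Conn Sᶜ c a ∧ ¬ G.Conn Sᶜ c b ∧ ¬ G.Conn Sᶜ a b)) →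
      ¬ (G.WalkAvoiding S (G.cluster Sᶜ a) c b ∨ G.WalkAvoiding S (G.cluster Sᶜ b) c a) →
      G.cluster Sᶜ a = {a} ∨ G.cluster Sᶜ b = {b}) :
    (univ.filter fun S : Config E => ((G.Conn S c a ∧ G.Conn S c b) ∧
        (¬ G.Conn Sᶜ c a ∧ ¬ G.Conn Sᶜ c b ∧ ¬ G.Conn Sᶜ a b)) ∧
        ¬ (G.WalkAvoiding S (G.cluster Sᶜ a) c b ∨ G.WalkAvoiding S (G.cluster Sᶜ b) c a)).card ≤
      2 * (univ.filter fun S : Config E => ((G.Conn S c a ∧ G.Conn S c b) ∧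
        (¬ G.Conn Sᶜ c a ∧ ¬ G.Conn Sᶜ c b ∧ ¬ G.Conn Sᶜ a b)) ∧
        (G.WalkAvoiding S (G.cluster Sᶜ a) c b ∧ G.WalkAvoiding S (G.cluster Sᶜ b) c a)).card := by
  set BadA := univ.filter fun S : Config E => (((G.Conn S c a ∧ G.Conn S c b) ∧
    (¬ G.Conn Sᶜ c a ∧ ¬ G.Conn Sᶜ c b ∧ ¬ G.Conn Sᶜ a b)) ∧ G.cluster Sᶜ a = {a}) ∧
    ¬ (G.WalkAvoiding S (G.cluster Sᶜ a) c b ∨ G.WalkAvoiding S (G.cluster Sᶜ b) c a) with hBadA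
  set BadB := univ.filter fun S : Config E => (((G.Conn S c a ∧ G.Conn S c b) ∧
    (¬ G.Conn Sᶜ c a ∧ ¬ G.Conn Sᶜ c b ∧ ¬ G.Conn Sᶜ a b)) ∧ G.cluster Sᶜ b = {b}) ∧
    ¬ (G.WalkAvoiding S (G.cluster Sᶜ a) c b ∨ G.WalkAvoiding S (G.cluster Sᶜ b) c a) with hBadB
  set GGA := univ.filter fun S : Config E => (((G.Conn S c a ∧ G.Conn S c b) ∧
    (¬ G.Conn Sᶜ c a ∧ ¬ G.Conn Sᶜ c b ∧ ¬ G.Conn Sᶜ a b)) ∧ G.cluster Sᶜ a = {a}) ∧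
    (G.WalkAvoiding S (G.cluster Sᶜ a) c b ∧ G.WalkAvoiding S (G.cluster Sᶜ b) c a) with hGGA
  set GGB := univ.filter fun S : Config E => (((G.Conn S c a ∧ G.Conn S c b) ∧
    (¬ G.Conn Sᶜ c a ∧ ¬ G.Conn Sᶜ c b ∧ ¬ G.Conn Sᶜ a b)) ∧ G.cluster Sᶜ b = {b}) ∧
    (G.WalkAvoiding S (G.cluster Sᶜ a) c b ∧ G.WalkAvoiding S (G.cluster Sᶜ b) c a) with hGGB
  set GG := univ.filter fun S : Config E => ((G.Conn S c a ∧ G.Conn S c b) ∧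
    (¬ G.Conn Sᶜ c a ∧ ¬ G.Conn Sᶜ c b ∧ ¬ G.Conn Sᶜ a b)) ∧
    (G.WalkAvoiding S (G.cluster Sᶜ a) c b ∧ G.WalkAvoiding S (G.cluster Sᶜ b) c a) with hGG
  have hA : BadA.card ≤ GGA.card := card_bad_le_card_gg_oneSidedA a b c
  have hB : BadB.card ≤ GGB.card := card_bad_le_card_gg_oneSidedB a b c
  have hGA : GGA.card ≤ GG.card := by
    apply card_le_card
    intro S hS
    rw [hGGA, mem_filter] at hS
    rw [hGG, mem_filter]
    exact ⟨hS.1, hS.2.1.1, hS.2.2⟩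
  have hGB : GGB.card ≤ GG.card := by
    apply card_le_card
    intro S hS
    rw [hGGB, mem_filter] at hS
    rw [hGG, mem_filter]
    exact ⟨hS.1, hS.2.1.1, hS.2.2⟩
  have hsub : (univ.filter fun S : Config E => ((G.Conn S c a ∧ G.Conn S c b) ∧
      (¬ G.Conn Sᶜ c a ∧ ¬ G.Conn Sᶜ c b ∧ ¬ G.Conn Sᶜ a b)) ∧
      ¬ (G.WalkAvoiding S (G.cluster Sᶜ a) c b ∨ G.WalkAvoiding S (G.cluster Sᶜ b) c a)) ⊆
      BadA ∪ BadB := by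
    intro S hS
    rw [mem_filter] at hS
    rw [mem_union, hBadA, hBadB, mem_filter, mem_filter]
    rcases h1 S hS.2.1 hS.2.2 with h | h
    · exact Or.inl ⟨hS.1, ⟨hS.2.1, h⟩, hS.2.2⟩
    · exact Or.inr ⟨hS.1, ⟨hS.2.1, h⟩, hS.2.2⟩
  have hcard := card_le_card hsub
  have hunion := card_union_le BadA BadB
  omega

omit [Fintype V] [DecidableEq V] in
open Classical in
/-- **No two-sided Bad source ⟹ the (CC) count**: `2·#Bad ≤ 4·#GG + #SG`, with room (`#SG` unused). -/
theorem bad_le_GG_SG_of_bad_oneSided (a b c : V)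
    (h1 : ∀ S : Config E, ((G.Conn S c a ∧ G.Conn S c b) ∧
        (¬ G.Conn Sᶜ c a ∧ ¬ G.Conn Sᶜ c b ∧ ¬ G.Conn Sᶜ a b)) →
      ¬ (G.WalkAvoiding S (G.cluster Sᶜ a) c b ∨ G.WalkAvoiding S (G.cluster Sᶜ b) c a) →
      G.cluster Sᶜ a = {a} ∨ G.cluster Sᶜ b = {b}) :
    2 * (univ.filter fun S : Config E => ((G.Conn S c a ∧ G.Conn S c b) ∧
          (¬ G.Conn Sᶜ c a ∧ ¬ G.Conn Sᶜ c b ∧ ¬ G.Conn Sᶜ a b)) ∧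
          ¬ (G.WalkAvoiding S (G.cluster Sᶜ a) c b ∨
            G.WalkAvoiding S (G.cluster Sᶜ b) c a)).card ≤
      4 * (univ.filter fun S : Config E => ((G.Conn S c a ∧ G.Conn S c b) ∧
          (¬ G.Conn Sᶜ c a ∧ ¬ G.Conn Sᶜ c b ∧ ¬ G.Conn Sᶜ a b)) ∧
          (G.WalkAvoiding S (G.cluster Sᶜ a) c b ∧ G.WalkAvoiding S (G.cluster Sᶜ b) c a)).card +
        (univ.filter fun S : Config E => ((G.Conn S c a ∧ G.Conn S c b) ∧
          (¬ G.Conn Sᶜ c a ∧ ¬ G.Conn Sᶜ c b ∧ ¬ G.Conn Sᶜ a b)) ∧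
          ((G.WalkAvoiding S (G.cluster Sᶜ a) c b ∧ ¬ G.WalkAvoiding S (G.cluster Sᶜ b) c a) ∨
            (G.WalkAvoiding S (G.cluster Sᶜ b) c a ∧
              ¬ G.WalkAvoiding S (G.cluster Sᶜ a) c b))).card := by
  have h := card_bad_le_two_mul_card_gg_of_bad_oneSided a b c h1
  omega

omit [Fintype V] [DecidableEq V] in
open Classical in
/-- **ROW C-041 `(G⅔)` on every skeleton without a two-sided Bad source**:
`2·n(D,A) ≤ 3·(#Good_a + #Good_b)` whenever every Bad source has a trivial blue cluster at `a` or at `b`. -/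
theorem goodDegree_of_bad_oneSided (a b c : V)
    (h1 : ∀ S : Config E, ((G.Conn S c a ∧ G.Conn S c b) ∧
        (¬ G.Conn Sᶜ c a ∧ ¬ G.Conn Sᶜ c b ∧ ¬ G.Conn Sᶜ a b)) →
      ¬ (G.WalkAvoiding S (G.cluster Sᶜ a) c b ∨ G.WalkAvoiding S (G.cluster Sᶜ b) c a) →
      G.cluster Sᶜ a = {a} ∨ G.cluster Sᶜ b = {b}) :
    2 * (univ.filter fun S : Config E => (G.Conn S c a ∧ G.Conn S c b) ∧
          (¬ G.Conn Sᶜ c a ∧ ¬ G.Conn Sᶜ c b ∧ ¬ G.Conn Sᶜ a b)).card ≤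
        3 * ((univ.filter fun S : Config E => ((G.Conn S c a ∧ G.Conn S c b) ∧
            (¬ G.Conn Sᶜ c a ∧ ¬ G.Conn Sᶜ c b ∧ ¬ G.Conn Sᶜ a b)) ∧
            G.WalkAvoiding S (G.cluster Sᶜ a) c b).card +
          (univ.filter fun S : Config E => ((G.Conn S c a ∧ G.Conn S c b) ∧
            (¬ G.Conn Sᶜ c a ∧ ¬ G.Conn Sᶜ c b ∧ ¬ G.Conn Sᶜ a b)) ∧
            G.WalkAvoiding S (G.cluster Sᶜ b) c a).card) :=
  (goodDegree_iff_bad_le_GG_SG a b c).2 (bad_le_GG_SG_of_bad_oneSided a b c h1)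

open Classical in
/-- **THEOREM L2 (live probe) on every skeleton without a two-sided Bad source.** -/
theorem pFun_threeCells_nonneg_of_bad_oneSided (a b c : V)
    (h1 : ∀ S : Config E, ((G.Conn S c a ∧ G.Conn S c b) ∧
        (¬ G.Conn Sᶜ c a ∧ ¬ G.Conn Sᶜ c b ∧ ¬ G.Conn Sᶜ a b)) →
      ¬ (G.WalkAvoiding S (G.cluster Sᶜ a) c b ∨ G.WalkAvoiding S (G.cluster Sᶜ b) c a) →
      G.cluster Sᶜ a = {a} ∨ G.cluster Sᶜ b = {b})
    {z κ x₁ K₁ x₂ K₂ : ℝ}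
    (hz : 0 ≤ z ∧ z ≤ 1) (hκ : kMin z ≤ κ) (hx₁ : 0 ≤ x₁ ∧ x₁ ≤ 1) (hx₂ : 0 ≤ x₂ ∧ x₂ ≤ 1)
    (hK₁ : kMin x₁ ≤ K₁) (hK₂ : kMin x₂ ≤ K₂) :
    0 ≤ G.pFun c (threeCells c a b z x₁ x₂) (threeCells c a b κ K₁ K₂) univ :=
  pFun_threeCells_nonneg_of_bad_le_GG_SG a b c (bad_le_GG_SG_of_bad_oneSided a b c h1)
    hz hκ hx₁ hx₂ hK₁ hK₂

end Count

end MultiGraph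

end PercRepro
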